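import Literature.AnabelianGeometry.AbsoluteAnabelian.AbsTopII.BelyiCuspidalization
import Literature.AnabelianGeometry.AbsoluteAnabelian.AbsTopII.EllipticCuspidalizationComparison
import Literature.AnabelianGeometry.AbsoluteAnabelian.AbsTopIII.KummerFaithfulSubpadicProofs
import Literature.AnabelianGeometry.AbsoluteAnabelian.SubpadicSlimProofs
import Literature.AnabelianGeometry.AbsoluteAnabelian.SubpadicIsGeneralizedSubpadic
import Literature.AnabelianGeometry.AbsoluteAnabelian.SubpadicExamples
import Literature.AnabelianGeometry.AbsoluteAnabelian.SlimTransport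
import HarnessLib

/-!
# [AbsTopII] Cor 3.3 / 3.4 / 3.7 / 3.8: the field-side hypotheses are kernel theorems for curves
# over sub-`p`-adic fields (in particular MLF's and NF's)

S. Mochizuki, *Topics in Absolute Anabelian Geometry II: Decomposition Groups and Endomorphisms*
[AbsTopII], §3 pp. 67–74 (manuscript pagination, lit key `paper:url-585b8d0ad0d9`; bib key
`MochizukiAbsTopII2013`).  Proof-only companion (no new definitions) to the typed statements
`BelyiCurveModel.Cor_3_7` / `Cor_3_8` (`AbsTopII/BelyiCuspidalization.lean`),
`BelyiModel.Cor_3_7` / `Cor_3_8` (`AbsTopII/CuspidalizationComparison.lean`) and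
`EllipticModel.Cor_3_3_*` / `Cor_3_4` (`AbsTopII/EllipticCuspidalizationComparison.lean`).

The standing hypotheses of these corollaries on the BASE FIELD `k` and its absolute Galois group
`G` — Cor 3.7 p. 72 (likewise Cor 3.3 p. 67): "`G` a slim profinite group; `1 → Δ → Π → G → 1` an
extension of GSAFG-type that admits partial construction data `(k, X, Σ)`, where `k` is of
characteristic zero, [...]. Suppose further that, for some `l ∈ Σ`, the cyclotomic character
`G → ℤ_l^×` has open image"; Remark 3.7.1 p. 73 / Remark 3.3.1 p. 69 (with [AbsTopI] Example 4.8
(i)): `k` generalized sub-`p`-adic — are, for a curve over a SUB-`p`-ADIC field `k` ([pGC] Def 15.4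
(i); the base fields of [AbsTopIII] Thm 1.9 p. 36–37: "Let `X` be a hyperbolic orbicurve of strictly
Belyi type [...] over a sub-`p`-adic field [...] `k`, for some prime `p`"), all THEOREMS of the
tree:

* `k` is generalized sub-`p`-adic: `AbsTopIII.IsSubpadic.exists_isGeneralizedSubpadicFor`
  ([Tpcs] Remark after Def 4.11; abc-iut-L4-t13, PROVED);
* `G` is slim: `pGC.lem_15_8_slim_holds` ([pGC] Lemma 15.8, abc-iut-L4-d2, PROVED unconditionally)
  transported along the model's `galIso : G ≅ Gal(k̄/k)` (`SlimTransport`, abc-iut-L4-t13);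
* `χ_l` has open image for some (indeed every) prime `l`:
  `AbsTopIII.IsSubpadic.isOpen_range_cyclotomicChar` ([AbsTopIII] Rmk 1.5.1 ∘ Rmk 1.5.4 (i),
  abc-iut-L4-d2/d3/t17, PROVED);
* MLF's and NF's are sub-`p`-adic: `AbsTopIII.IsSubpadic.of_isMLF` / `of_isNF` ([pGC] Def 15.4 (i)
  examples (1), (2); abc-iut-L4-t13, PROVED).

Hence (this file): `BelyiCurveModel.isCor37Input_of_isSubpadic` — the INPUT class of Cor 3.7 for a
curve of strictly Belyi type over a sub-`p`-adic field is exactly the input class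
`IsStrictlyBelyiType X ∧ IsSubpadic k` of [AbsTopIII] Thm 1.9 (abc-iut-L4-t1
`CurveModel.IsThm19Input`; chain audit `plan/L4/LC1-CHAIN.md` §1d, links L3c → L2c), and likewise
`_of_isMLF` / `_of_isNF` (the [AbsTopIII] Cor 1.10 / [IUTchI] situations); the COMMON prime `l` of
Cor 3.8 / Cor 3.4 for two curves over sub-`p`-adic fields may be taken to be ANY prime
(`commonPrime_of_isSubpadic`); and the corollaries specialise to hypothesis lists that mention no
slimness, no cyclotomic character and no `p` (`cor_3_7_of_isSubpadic`, `cor_3_8_of_isSubpadic`, …).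
The general-`𝒟` member predicates `BelyiModel.IsCor37Member` / `EllipticModel.IsCor33Member`
(whose `G` is LITERALLY `Gal(k̄_b/k_b)`) receive the same supply (`isCor37Member_of_isSubpadic`,
`isCor33Member_of_isSubpadic`).

HONEST FRAMING: this discharges SIDE HYPOTHESES of refereed statements typed as named Prop-valued
facts relative to a model; the corollaries themselves (`Cor_3_7`, `Cor_3_8`, `Cor_3_3_*`, `Cor_3_4`)
remain hypotheses (FACT boundary: the étale `π₁` and Belyi/elliptic cuspidalization are not
constructed in the tree).  Nothing here bears on [IUTchIII] Cor 3.12; typed ≠ discharged.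
-/

noncomputable section

open CategoryTheory

namespace Literature.AnabelianGeometry.AbsoluteAnabelian.AbsTopII

open Literature.AlgebraicGeometry.Frobenioids (IsSlimGroup)
open Literature.AnabelianGeometry.Anabelioids (IsSigmaInteger)
open AbsTopIII (IsSubpadic cyclotomicChar)

universe u

/-! ### Sub-`p`-adic base fields: slimness of `G` and the cyclotomic hypothesis -/

/-- For a sub-`p`-adic field `k`, EVERY prime `l` witnesses the hypothesis "Suppose further that,
for some `l ∈ Σ`, the cyclotomic character `G → ℤ_l^×` has open image" of Cor 3.7 p. 72 (for `G =
G_k`), by [AbsTopIII] Rmk 1.5.1 / 1.5.4 (i) (`IsSubpadic.isOpen_range_cyclotomicChar`). [cite: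
MochizukiAbsTopII2013, Cor 3.7 p.72] -/
theorem exists_isOpen_range_cyclotomicChar_of_isSubpadic {k : Type u} [Field k]
    (hk : IsSubpadic k) :
    ∃ (l : ℕ) (_ : Fact l.Prime), IsOpen (Set.range (cyclotomicChar k l)) :=
  ⟨2, Nat.fact_prime_two, hk.isOpen_range_cyclotomicChar 2⟩

/-- The COMMON prime of Cor 3.8 p. 74 / Cor 3.4 p. 70 ("Suppose further that, for some `l ∈ Σ₁ ∩
Σ₂`, the cyclotomic characters `Gᵢ → ℤ_l^×` have open image for `i = 1, 2`") for two sub-`p`-adic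
base fields (possibly for different `p`): any prescribed prime `l` works. [cite:
MochizukiAbsTopII2013, Cor 3.8 p.74] -/
theorem commonPrime_of_isSubpadic {k₁ k₂ : Type u} [Field k₁] [Field k₂]
    (hk₁ : IsSubpadic k₁) (hk₂ : IsSubpadic k₂) (l : ℕ) [Fact l.Prime] :
    IsOpen (Set.range (cyclotomicChar k₁ l)) ∧ IsOpen (Set.range (cyclotomicChar k₂ l)) :=
  ⟨hk₁.isOpen_range_cyclotomicChar l, hk₂.isOpen_range_cyclotomicChar l⟩

/-- Existential form of `commonPrime_of_isSubpadic` — literally the cyclotomic hypothesis of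
`BelyiCurveModel.Cor_3_8` / `BelyiModel.Cor_3_8`. [cite: MochizukiAbsTopII2013, Cor 3.8 p.74] -/
theorem exists_commonPrime_of_isSubpadic {k₁ k₂ : Type u} [Field k₁] [Field k₂]
    (hk₁ : IsSubpadic k₁) (hk₂ : IsSubpadic k₂) :
    ∃ (l : ℕ) (_ : Fact l.Prime),
      IsOpen (Set.range (cyclotomicChar k₁ l)) ∧ IsOpen (Set.range (cyclotomicChar k₂ l)) :=
  ⟨2, Nat.fact_prime_two, commonPrime_of_isSubpadic hk₁ hk₂ 2⟩

/-- "`G` a slim profinite group" (Cor 3.7 p. 72) for any profinite group identified with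
`Gal(k̄/k)`, `k` sub-`p`-adic — [pGC] Lemma 15.8 as quoted in [AbsTopI] Ex 4.8 (ii), now a theorem
of the tree (`pGC.lem_15_8_slim_holds`), transported along the identification.
[cite: MochizukiAbsTopII2013, Cor 3.7 p.72] -/
theorem isSlimGroup_of_iso_absoluteGaloisGrp {k : Type u} [Field k] [CharZero k]
    (hk : IsSubpadic k) {Γ : ProfiniteGrp.{u}} (i : Γ ≅ absoluteGaloisGrp k) : IsSlimGroup Γ :=
  isSlimGroup_of_iso_absoluteGaloisGrp_of_isSubpadic pGC.lem_15_8_slim_holds hk i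

/-! ### Cor 3.7 / 3.8 over `BelyiCurveModel` (instantiated form of Rmk 3.7.1) -/

namespace BelyiCurveModel

variable (M : BelyiCurveModel.{u})

/-- "`G` a slim profinite group" for a curve of the model over a sub-`p`-adic base field: `G ≅ G_k`
(`M.galIso`) and `G_k` is slim ([pGC] Lem 15.8, PROVED in the tree).
[cite: MochizukiAbsTopII2013, Cor 3.7 p.72] -/
theorem isSlimGroup_gal_of_isSubpadic (X : M.Curve) (hk : IsSubpadic (M.base X)) :
    IsSlimGroup (M.ext X).gal :=
  isSlimGroup_of_iso_absoluteGaloisGrp hk (M.galIso X)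

/-- **The input class of Cor 3.7 over a sub-`p`-adic field is that of [AbsTopIII] Thm 1.9**: for a
curve `X` of strictly Belyi type (Def 3.5) over a sub-`p`-adic field `k`, every standing hypothesis
of Cor 3.7 p. 72 / Rmk 3.7.1 p. 73 holds — `k` generalized sub-`p`-adic ([Tpcs] Rmk after Def 4.11),
`G` slim ([pGC] Lem 15.8), `χ_l` open for some `l` ([AbsTopIII] Rmk 1.5.1/1.5.4 (i)) — all PROVED in
the tree. [cite: MochizukiAbsTopII2013, Cor 3.7 p.72] -/
theorem isCor37Input_of_isSubpadic {X : M.Curve} (hB : M.IsStrictlyBelyiType X)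
    (hk : IsSubpadic (M.base X)) : M.IsCor37Input X where
  strictlyBelyi := hB
  generalizedSubpadic := hk.exists_isGeneralizedSubpadicFor
  slim := M.isSlimGroup_gal_of_isSubpadic X hk
  cyclotomicallyFull := exists_isOpen_range_cyclotomicChar_of_isSubpadic hk

/-- Over a sub-`p`-adic base field the input predicate of Cor 3.7 is EQUIVALENT to its first
clause, `X` of strictly Belyi type (Def 3.5). [cite: MochizukiAbsTopII2013, Cor 3.7 p.72] -/
theorem isCor37Input_iff_of_isSubpadic {X : M.Curve} (hk : IsSubpadic (M.base X)) :
    M.IsCor37Input X ↔ M.IsStrictlyBelyiType X :=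
  ⟨fun h => h.strictlyBelyi, fun hB => M.isCor37Input_of_isSubpadic hB hk⟩

/-- The [AbsTopIII] Cor 1.10 (iii) / [IUTchI] situation: a curve of strictly Belyi type over an MLF
satisfies every standing hypothesis of Cor 3.7 (an MLF is sub-`p`-adic, [pGC] Def 15.4 (i) (1)).
[cite: MochizukiAbsTopII2013, Cor 3.7 p.72] -/
theorem isCor37Input_of_isMLF {X : M.Curve} (hB : M.IsStrictlyBelyiType X)
    (hk : IsMLF (M.base X)) : M.IsCor37Input X :=
  M.isCor37Input_of_isSubpadic hB (AbsTopIII.IsSubpadic.of_isMLF hk)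

/-- A curve of strictly Belyi type over a number field satisfies every standing hypothesis of Cor
3.7 (an NF is sub-`p`-adic, [pGC] Def 15.4 (i) (2)). [cite: MochizukiAbsTopII2013, Cor 3.7 p.72] -/
theorem isCor37Input_of_isNF {X : M.Curve} (hB : M.IsStrictlyBelyiType X)
    (hk : IsNF (M.base X)) : M.IsCor37Input X :=
  M.isCor37Input_of_isSubpadic hB (AbsTopIII.IsSubpadic.of_isNF hk)

/-- **Cor 3.7 for curves of strictly Belyi type over sub-`p`-adic fields** (PROVED reduction): given
the named fact `Cor_3_7`, its conclusion holds for every `X` of strictly Belyi type over a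
sub-`p`-adic field and every NF-rational open `U_X` — the hypothesis list of [AbsTopIII] Thm 1.9
(a), with no slimness / cyclotomic / `p` clause left. [cite: MochizukiAbsTopII2013, Cor 3.7
pp.72-73] -/
theorem cor_3_7_of_isSubpadic (h37 : M.Cor_3_7) {X : M.Curve} (hB : M.IsStrictlyBelyiType X)
    (hk : IsSubpadic (M.base X)) (U : M.Open X) :
    ∃ B : BelyiCuspidalization (M.ext X), B.cusp.IsoOver (M.cuspOf U) ∧
      B.cusp.decompositionImages B.cusps = (M.cuspOf U).decompositionImages (M.cuspsOf U) :=
  h37 X (M.isCor37Input_of_isSubpadic hB hk) U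

/-- Cor 3.7 for curves of strictly Belyi type over an MLF (PROVED reduction from `Cor_3_7`).
[cite: MochizukiAbsTopII2013, Cor 3.7 pp.72-73] -/
theorem cor_3_7_of_isMLF (h37 : M.Cor_3_7) {X : M.Curve} (hB : M.IsStrictlyBelyiType X)
    (hk : IsMLF (M.base X)) (U : M.Open X) :
    ∃ B : BelyiCuspidalization (M.ext X), B.cusp.IsoOver (M.cuspOf U) ∧
      B.cusp.decompositionImages B.cusps = (M.cuspOf U).decompositionImages (M.cuspsOf U) :=
  M.cor_3_7_of_isSubpadic h37 hB (AbsTopIII.IsSubpadic.of_isMLF hk) U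

/-- Cor 3.7 for curves of strictly Belyi type over a number field (PROVED reduction from `Cor_3_7`).
[cite: MochizukiAbsTopII2013, Cor 3.7 pp.72-73] -/
theorem cor_3_7_of_isNF (h37 : M.Cor_3_7) {X : M.Curve} (hB : M.IsStrictlyBelyiType X)
    (hk : IsNF (M.base X)) (U : M.Open X) :
    ∃ B : BelyiCuspidalization (M.ext X), B.cusp.IsoOver (M.cuspOf U) ∧
      B.cusp.decompositionImages B.cusps = (M.cuspOf U).decompositionImages (M.cuspsOf U) :=
  M.cor_3_7_of_isSubpadic h37 hB (AbsTopIII.IsSubpadic.of_isNF hk) U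

/-- **Cor 3.8 for two curves of strictly Belyi type over sub-`p`-adic fields** (PROVED reduction):
given the named fact `Cor_3_8`, for `X₁/k₁`, `X₂/k₂` of strictly Belyi type with `k₁`, `k₂`
sub-`p`-adic (the primes may differ) and `φ` as in print ("Let `φ : Π₁ ⥲ Π₂` be an isomorphism of
profinite groups such that `φ(Δ₁) = Δ₂`."), the comparison conclusion of Cor 3.8 p. 74 holds; the
common prime `l` of the cyclotomic hypothesis is supplied by `exists_commonPrime_of_isSubpadic`.
[cite: MochizukiAbsTopII2013, Cor 3.8 p.74] -/
theorem cor_3_8_of_isSubpadic (h38 : M.Cor_3_8) {X₁ X₂ : M.Curve}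
    (hB₁ : M.IsStrictlyBelyiType X₁) (hk₁ : IsSubpadic (M.base X₁))
    (hB₂ : M.IsStrictlyBelyiType X₂) (hk₂ : IsSubpadic (M.base X₂))
    (φ : (M.ext X₁).arith ≃ₜ* (M.ext X₂).arith)
    (hφ : (M.ext X₁).geom.map φ.toMonoidHom = (M.ext X₂).geom) (U₁ : M.Open X₁) :
    ∃ U₂ : M.Open X₂,
      (∃ φU : (M.cuspOf U₁).ext.arith ≃ₜ* (M.cuspOf U₂).ext.arith,
          ∀ x, (M.cuspOf U₂).hom.arith (φU x) = φ ((M.cuspOf U₁).hom.arith x)) ∧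
      ∀ φU φU' : (M.cuspOf U₁).ext.arith ≃ₜ* (M.cuspOf U₂).ext.arith,
        (∀ x, (M.cuspOf U₂).hom.arith (φU x) = φ ((M.cuspOf U₁).hom.arith x)) →
        (∀ x, (M.cuspOf U₂).hom.arith (φU' x) = φ ((M.cuspOf U₁).hom.arith x)) →
          ∃ g : (M.cuspOf U₂).ext.arith, (M.cuspOf U₂).hom.arith g = 1 ∧
            ∀ x, φU' x = g * φU x * g⁻¹ :=
  h38 X₁ X₂ (M.isCor37Input_of_isSubpadic hB₁ hk₁) (M.isCor37Input_of_isSubpadic hB₂ hk₂)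
    (exists_commonPrime_of_isSubpadic hk₁ hk₂) φ hφ U₁

/-- Cor 3.8 for two curves of strictly Belyi type over MLF's (possibly of different residue
characteristics; PROVED reduction from `Cor_3_8`). [cite: MochizukiAbsTopII2013, Cor 3.8 p.74] -/
theorem cor_3_8_of_isMLF (h38 : M.Cor_3_8) {X₁ X₂ : M.Curve}
    (hB₁ : M.IsStrictlyBelyiType X₁) (hk₁ : IsMLF (M.base X₁))
    (hB₂ : M.IsStrictlyBelyiType X₂) (hk₂ : IsMLF (M.base X₂))
    (φ : (M.ext X₁).arith ≃ₜ* (M.ext X₂).arith)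
    (hφ : (M.ext X₁).geom.map φ.toMonoidHom = (M.ext X₂).geom) (U₁ : M.Open X₁) :
    ∃ U₂ : M.Open X₂,
      (∃ φU : (M.cuspOf U₁).ext.arith ≃ₜ* (M.cuspOf U₂).ext.arith,
          ∀ x, (M.cuspOf U₂).hom.arith (φU x) = φ ((M.cuspOf U₁).hom.arith x)) ∧
      ∀ φU φU' : (M.cuspOf U₁).ext.arith ≃ₜ* (M.cuspOf U₂).ext.arith,
        (∀ x, (M.cuspOf U₂).hom.arith (φU x) = φ ((M.cuspOf U₁).hom.arith x)) →
        (∀ x, (M.cuspOf U₂).hom.arith (φU' x) = φ ((M.cuspOf U₁).hom.arith x)) →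
          ∃ g : (M.cuspOf U₂).ext.arith, (M.cuspOf U₂).hom.arith g = 1 ∧
            ∀ x, φU' x = g * φU x * g⁻¹ :=
  M.cor_3_8_of_isSubpadic h38 hB₁ (AbsTopIII.IsSubpadic.of_isMLF hk₁) hB₂
    (AbsTopIII.IsSubpadic.of_isMLF hk₂) φ hφ U₁

/-- `Cor_3_8.self_iso` with the sub-`p`-adic input list: for `φ = id` on one curve of strictly
Belyi type over a sub-`p`-adic field, each `U₁` has some `U₂` with isomorphic cuspidalization
(sanity consequence; PROVED from `Cor_3_8`). [cite: MochizukiAbsTopII2013, Cor 3.8 p.74] -/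
theorem cor_3_8_self_iso_of_isSubpadic (h38 : M.Cor_3_8) {X : M.Curve}
    (hB : M.IsStrictlyBelyiType X) (hk : IsSubpadic (M.base X)) (U₁ : M.Open X) :
    ∃ U₂ : M.Open X, (M.cuspOf U₁).IsoOver (M.cuspOf U₂) :=
  Cor_3_8.self_iso h38 X (M.isCor37Input_of_isSubpadic hB hk) U₁

end BelyiCurveModel

/-! ### Cor 3.7 / 3.8 and Cor 3.3 / 3.4 relative to a class `𝒟` (printed generality) -/

section ConstructionData

open AbsTopI

variable {𝒟 : ConstructionDataClass.{u}}

/-- For a member over the construction-data field `k_b`, the group `G` is literally `Gal(k̄_b/k_b)`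
(`absoluteGaloisGrp (𝒟.fld b)`); if `k_b` is sub-`p`-adic, `G` is slim ([pGC] Lem 15.8, PROVED
in the tree). [cite: MochizukiAbsTopII2013, Cor 3.7 p.72] -/
theorem isSlimGroup_gal_ext_of_isSubpadic (b : 𝒟.Base) (X : (𝒟.datum b).Obj)
    (hk : IsSubpadic (𝒟.fld b)) : IsSlimGroup ((𝒟.datum b).ext X).gal :=
  isSlimGroup_of_iso_absoluteGaloisGrp hk (Iso.refl _)

namespace BelyiModel

variable (M : BelyiModel 𝒟)

/-- **The standing hypotheses of Cor 3.7 for a member over a sub-`p`-adic construction-data field**: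
membership, `Σ` = all primes, strictly Belyi type and slim nontrivial `Δ` (GSAFG-type, hyperbolic
orbicurve) are the INPUTS; the slimness of `G` and the open image of some `χ_l` are SUPPLIED by
[pGC] Lem 15.8 and [AbsTopIII] Rmk 1.5.1/1.5.4 (i) (both PROVED in the tree). [cite:
MochizukiAbsTopII2013, Cor 3.7 p.72] -/
theorem isCor37Member_of_isSubpadic {b : 𝒟.Base} {X : (𝒟.datum b).Obj} (hmem : 𝒟.Mem b X)
    (hprimes : (𝒟.datum b).primes = Set.univ) (hB : M.IsStrictlyBelyiType b X)
    (hk : IsSubpadic (𝒟.fld b)) (hΔ : IsSlimGroup ((𝒟.datum b).ext X).geom)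
    (hne : ((𝒟.datum b).ext X).geom ≠ ⊥) : M.IsCor37Member b X where
  mem := hmem
  primes_eq := hprimes
  strictlyBelyi := hB
  slim := isSlimGroup_gal_ext_of_isSubpadic b X hk
  cyclotomic := exists_isOpen_range_cyclotomicChar_of_isSubpadic hk
  geom_slim := hΔ
  geom_ne_bot := hne

/-- **Cor 3.7 (printed generality) for members over sub-`p`-adic construction-data fields** (PROVED
reduction): given `Cor_3_7` and the `𝒟`-hypotheses chain-full / rel-isom-DGC ([AbsTopI] Def 4.6),
the conclusion holds for every member with `Σ` = all primes, of strictly Belyi type, with slim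
nontrivial `Δ`, over a sub-`p`-adic `k_b`, and every NF-rational open `U_X`.
[cite: MochizukiAbsTopII2013, Cor 3.7 pp.72-73] -/
theorem cor_3_7_of_isSubpadic (h37 : M.Cor_3_7) (hfull : 𝒟.IsChainFull) (hGC : 𝒟.RelIsomDGC)
    {b : 𝒟.Base} {X : (𝒟.datum b).Obj} (hmem : 𝒟.Mem b X)
    (hprimes : (𝒟.datum b).primes = Set.univ) (hB : M.IsStrictlyBelyiType b X)
    (hk : IsSubpadic (𝒟.fld b)) (hΔ : IsSlimGroup ((𝒟.datum b).ext X).geom)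
    (hne : ((𝒟.datum b).ext X).geom ≠ ⊥) (U : M.NFOpen b X) :
    ∃ B : BelyiCuspidalization ((𝒟.datum b).ext X),
      B.cusp.IsoOver (M.cuspOf U) ∧
        B.cusp.decompositionImages B.cusps = (M.cuspOf U).decompositionImages (M.cuspsOf U) ∧
        HasTerminalChainOfType (M.cusps b X)
          (M.isCor37Member_of_isSubpadic hmem hprimes hB hk hΔ hne).arith_slim hΔ hne
          B.typeChain B.PiV :=
  h37 hfull hGC b X (M.isCor37Member_of_isSubpadic hmem hprimes hB hk hΔ hne) U

/-- **Cor 3.8 (printed generality) for two members over sub-`p`-adic construction-data fields**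
(PROVED reduction): given `Cor_3_8` and the `𝒟`-hypotheses, the comparison conclusion holds for any
two members (`Σᵢ` = all primes, strictly Belyi type, slim nontrivial `Δᵢ`) over sub-`p`-adic fields
`k_{b₁}`, `k_{b₂}` (possibly different `p`) and any `φ : Π₁ ⥲ Π₂` with `φ(Δ₁) = Δ₂`; the common
prime `l` is supplied by `exists_commonPrime_of_isSubpadic`. [cite: MochizukiAbsTopII2013, Cor 3.8
p.74] -/
theorem cor_3_8_of_isSubpadic (h38 : M.Cor_3_8) (hfull : 𝒟.IsChainFull) (hGC : 𝒟.RelIsomDGC)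
    {b₁ b₂ : 𝒟.Base} {X₁ : (𝒟.datum b₁).Obj} {X₂ : (𝒟.datum b₂).Obj}
    (hmem₁ : 𝒟.Mem b₁ X₁) (hmem₂ : 𝒟.Mem b₂ X₂)
    (hprimes₁ : (𝒟.datum b₁).primes = Set.univ) (hprimes₂ : (𝒟.datum b₂).primes = Set.univ)
    (hB₁ : M.IsStrictlyBelyiType b₁ X₁) (hB₂ : M.IsStrictlyBelyiType b₂ X₂)
    (hk₁ : IsSubpadic (𝒟.fld b₁)) (hk₂ : IsSubpadic (𝒟.fld b₂))
    (hΔ₁ : IsSlimGroup ((𝒟.datum b₁).ext X₁).geom) (hne₁ : ((𝒟.datum b₁).ext X₁).geom ≠ ⊥)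
    (hΔ₂ : IsSlimGroup ((𝒟.datum b₂).ext X₂).geom) (hne₂ : ((𝒟.datum b₂).ext X₂).geom ≠ ⊥)
    (φ : ((𝒟.datum b₁).ext X₁).arith ≃ₜ* ((𝒟.datum b₂).ext X₂).arith)
    (hφ : ((𝒟.datum b₁).ext X₁).geom.map φ.toMonoidHom = ((𝒟.datum b₂).ext X₂).geom)
    (U₁ : M.NFOpen b₁ X₁) :
    ∃ U₂ : M.NFOpen b₂ X₂,
      (∃ φU : (M.cuspOf U₁).ext.arith ≃ₜ* (M.cuspOf U₂).ext.arith,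
          ∀ x, (M.cuspOf U₂).hom.arith (φU x) = φ ((M.cuspOf U₁).hom.arith x)) ∧
      ∀ φU φU' : (M.cuspOf U₁).ext.arith ≃ₜ* (M.cuspOf U₂).ext.arith,
        (∀ x, (M.cuspOf U₂).hom.arith (φU x) = φ ((M.cuspOf U₁).hom.arith x)) →
        (∀ x, (M.cuspOf U₂).hom.arith (φU' x) = φ ((M.cuspOf U₁).hom.arith x)) →
          ∃ g : (M.cuspOf U₂).ext.arith, (M.cuspOf U₂).hom.arith g = 1 ∧
            ∀ x, φU' x = g * φU x * g⁻¹ :=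
  h38 hfull hGC b₁ b₂ X₁ X₂ (M.isCor37Member_of_isSubpadic hmem₁ hprimes₁ hB₁ hk₁ hΔ₁ hne₁)
    (M.isCor37Member_of_isSubpadic hmem₂ hprimes₂ hB₂ hk₂ hΔ₂ hne₂)
    (exists_commonPrime_of_isSubpadic hk₁ hk₂) φ hφ U₁

end BelyiModel

namespace EllipticModel

variable (M : EllipticModel 𝒟)

/-- **The standing hypotheses of Cor 3.3 / 3.4 for a member over a sub-`p`-adic construction-data
field**: membership, `Π`-elliptic admissibility and slim nontrivial `Δ` are the INPUTS, together
with ONE prime `l ∈ Σ` (Cor 3.3 p. 67: "Suppose further that, for some `l ∈ Σ`, the cyclotomic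
character `G → ℤ_l^×` has open image"); the slimness of `G` and the open image of `χ_l` are SUPPLIED
([pGC] Lem 15.8; [AbsTopIII] Rmk 1.5.1/1.5.4 (i) for EVERY prime `l`, both PROVED in the tree).
[cite: MochizukiAbsTopII2013, Cor 3.3 p.67] -/
theorem isCor33Member_of_isSubpadic {b : 𝒟.Base} {X : (𝒟.datum b).Obj} (hmem : 𝒟.Mem b X)
    (hX : M.IsEllipticallyAdmissible b X) (hk : IsSubpadic (𝒟.fld b))
    {l : ℕ} [Fact l.Prime] (hl : l ∈ (𝒟.datum b).primes)
    (hΔ : IsSlimGroup ((𝒟.datum b).ext X).geom) (hne : ((𝒟.datum b).ext X).geom ≠ ⊥) :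
    M.IsCor33Member b X where
  mem := hmem
  ellipticallyAdmissible := hX
  slim := isSlimGroup_gal_ext_of_isSubpadic b X hk
  cyclotomic := ⟨l, inferInstance, hl, hk.isOpen_range_cyclotomicChar l⟩
  geom_slim := hΔ
  geom_ne_bot := hne

/-- The same when `Σ` = all primes (no `l` to name: take `l = 2`).
[cite: MochizukiAbsTopII2013, Cor 3.3 p.67] -/
theorem isCor33Member_of_isSubpadic_of_primes_eq_univ {b : 𝒟.Base} {X : (𝒟.datum b).Obj}
    (hmem : 𝒟.Mem b X) (hX : M.IsEllipticallyAdmissible b X) (hk : IsSubpadic (𝒟.fld b))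
    (hprimes : (𝒟.datum b).primes = Set.univ)
    (hΔ : IsSlimGroup ((𝒟.datum b).ext X).geom) (hne : ((𝒟.datum b).ext X).geom ≠ ⊥) :
    M.IsCor33Member b X :=
  haveI := Nat.fact_prime_two
  M.isCor33Member_of_isSubpadic hmem hX hk (l := 2) (by rw [hprimes]; trivial) hΔ hne

/-- **Cor 3.4 (printed generality) for two members over sub-`p`-adic construction-data fields**
(PROVED reduction): given `Cor_3_4` and the `𝒟`-hypotheses, the comparison conclusion holds for any
two `Π`-elliptically admissible members with slim nontrivial `Δᵢ` over sub-`p`-adic `k_{b₁}`,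
`k_{b₂}`, settings with one common `Σ₁ ∩ Σ₂`-integer `N`, one prime `l ∈ Σ₁ ∩ Σ₂` (print p. 70:
"for some `l ∈ Σ₁ ∩ Σ₂`"; its cyclotomic clause is SUPPLIED for both fields), and any `φ : Π₁ ⥲ Π₂`
with `φ(Δ₁) = Δ₂`. [cite: MochizukiAbsTopII2013, Cor 3.4 pp.69-70] -/
theorem cor_3_4_of_isSubpadic (h34 : M.Cor_3_4) (hfull : 𝒟.IsChainFull) (hGC : 𝒟.RelIsomDGC)
    {b₁ b₂ : 𝒟.Base} {X₁ : (𝒟.datum b₁).Obj} {X₂ : (𝒟.datum b₂).Obj}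
    (hmem₁ : 𝒟.Mem b₁ X₁) (hmem₂ : 𝒟.Mem b₂ X₂)
    (hX₁ : M.IsEllipticallyAdmissible b₁ X₁) (hX₂ : M.IsEllipticallyAdmissible b₂ X₂)
    (hk₁ : IsSubpadic (𝒟.fld b₁)) (hk₂ : IsSubpadic (𝒟.fld b₂))
    {l : ℕ} [Fact l.Prime] (hl₁ : l ∈ (𝒟.datum b₁).primes) (hl₂ : l ∈ (𝒟.datum b₂).primes)
    (hΔ₁ : IsSlimGroup ((𝒟.datum b₁).ext X₁).geom) (hne₁ : ((𝒟.datum b₁).ext X₁).geom ≠ ⊥)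
    (hΔ₂ : IsSlimGroup ((𝒟.datum b₂).ext X₂).geom) (hne₂ : ((𝒟.datum b₂).ext X₂).geom ≠ ⊥)
    (s₁ : M.Setting b₁ X₁) (s₂ : M.Setting b₂ X₂) (hN : M.level s₁ = M.level s₂)
    (hNprimes : IsSigmaInteger ((𝒟.datum b₁).primes ∩ (𝒟.datum b₂).primes) (M.level s₁))
    (φ : ((𝒟.datum b₁).ext X₁).arith ≃ₜ* ((𝒟.datum b₂).ext X₂).arith)
    (hφ : ((𝒟.datum b₁).ext X₁).geom.map φ.toMonoidHom = ((𝒟.datum b₂).ext X₂).geom) :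
    (∃ φU : (M.cuspUX s₁).ext.arith ≃ₜ* (M.cuspUX s₂).ext.arith,
        ∀ x, (M.cuspUX s₂).hom.arith (φU x) = φ ((M.cuspUX s₁).hom.arith x)) ∧
      ∀ φU φU' : (M.cuspUX s₁).ext.arith ≃ₜ* (M.cuspUX s₂).ext.arith,
        (∀ x, (M.cuspUX s₂).hom.arith (φU x) = φ ((M.cuspUX s₁).hom.arith x)) →
        (∀ x, (M.cuspUX s₂).hom.arith (φU' x) = φ ((M.cuspUX s₁).hom.arith x)) →
          ∃ g : (M.cuspUX s₂).ext.arith, (M.cuspUX s₂).hom.arith g = 1 ∧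
            ∀ x, φU' x = g * φU x * g⁻¹ :=
  h34 hfull hGC b₁ b₂ X₁ X₂ (M.isCor33Member_of_isSubpadic hmem₁ hX₁ hk₁ hl₁ hΔ₁ hne₁)
    (M.isCor33Member_of_isSubpadic hmem₂ hX₂ hk₂ hl₂ hΔ₂ hne₂) s₁ s₂ hN hNprimes
    ⟨l, inferInstance, hl₁, hl₂, commonPrime_of_isSubpadic hk₁ hk₂ l⟩ φ hφ

end EllipticModel

end ConstructionData

end Literature.AnabelianGeometry.AbsoluteAnabelian.AbsTopII
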